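import Mathlib
import Literature.MathematicalPhysics.MHD.BallooningSAlphaStableSide
import HarnessLib

/-!
# THE MASTER RICCATI PHASE OF THE `s–α` BALLOONING OPERATOR: for every constant `b` and every `C¹` function `n`,
# the phase `φ = (Λ(α cos θ + b) + n)/(1 + Λ²)` has residual EXACTLY
# `α(1 + s + b) cos θ + b(s + b) + n′ + n² − (α cos θ + b − Λn)²/(1 + Λ²)`
# — one identity behind the certified first region (`b = −α − √α`), the negative-shear half-plane (`b = −(1 + s)`), the
# lens (`b = √α − α`), the line `s = −1` (`b = 0`) and lit-4's amplitude equation (`b = −s`, `n = (1 + Λ²)F′/F`: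
# residual `= (1 + Λ²)(F″/F + Q)`, `Q = α cos θ/(1 + Λ²) − ŝ²/(1 + Λ²)²`); a supersolution is ONE scalar inequality

Topic `Literature/MathematicalPhysics/MHD` (namespace = path; sub-namespace `Ballooning.SAlpha`).  Written for the venture ladder GRIDFUSION,
rung F3, by gridfusion-lit-3 (g15), 2026-08-28, over lit-3's `BallooningSAlpha.lean` ((12.97): `Λ = sθ − α sin θ`, `ŝ = s − α cos θ`,
`f = 1 + Λ²`, `g = α(Λ sin θ + cos θ)`) and lit-4's `BallooningSAlphaStableSide.lean` (`riccatiResidual φ φ′ = 2Λŝφ + fφ′ + fφ² + g`,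
`energyDominatesOn_of_riccati`, `EnergyDominatesOn`, `StableSide`) BY IMPORT.  0 named facts, 0 kit, no `decide`.  PURPOSE: a single
socket for every lane that certifies the STABLE side — choose `b` and `n` (closed form, spline, Taylor model …), verify the displayed scalar
inequality on the window, get `EnergyDominatesOn` (hence `StableSide` on `univ`, or a core / tail piece for lit-4's `stableSide_of_core_tail`).

## What is PROVED (everything; 0 facts)
* §1 `masterPhase s α b n θ = (Λ(α cos θ + b) + n θ)/(1 + Λ²)` and its derivative from `n′` (`masterPhaseDeriv`, `hasDerivAt_masterPhase`).
* §2 ★★ `riccatiResidual_masterPhase` — THE IDENTITY (pure algebra after the product rule; `(Λ m)′ = ŝm − αΛ sin θ` cancels `αΛ sin θ` of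
  `g`, and `(Λm + n)²/(1 + Λ²) = m² + n² − (m − Λn)²/(1 + Λ²)` with `m = α cos θ + b`, `ŝm + m² + α cos θ = α(1 + s + b) cos θ + b(s + b)`).
* §3 ★★ `energyDominatesOn_masterPhase` — on any set `S`: if `n` is `C¹` on `S` and
  `α(1 + s + b) cos θ + b(s + b) + n′ + n² ≤ (α cos θ + b − Λn)²/(1 + Λ²)` on `S`, the master phase dominates the energy on `S`;
  ★ `stableSide_of_masterPhase` (`S = ℝ`).  ★ `riccatiResidual_masterPhase_const` — the case `n ≡ 0`:
  residual `= α(1 + s + b) cos θ + b(s + b) − (α cos θ + b)²/(1 + Λ²)`, whence `stableSide_of_const` under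
  `|α(1 + s + b)| + b(s + b) ≤ 0` (example `stableSide_of_const_lens`) — solvable in `b` in particular when `s ≤ −1`, or `α ≥ 0 ∧ s ≥ α + 2√α`, or
  `0 ≤ α ≤ 1 ∧ −1 ≤ s ≤ α − 2√α` (the three certified regions of `BallooningSAlphaShearlessStable.lean` / `…FirstRegionSqrt.lean`).
* §4 ★ `riccatiResidual_masterPhase_liouville` — `b = −s`: residual `= α cos θ + n′ + n² − (ŝ + Λn)²/(1 + Λ²)`; for a TAIL one takes
  `n = −α sin θ + (2α cos θ − (α²/2s) cos 2θ + K)/θ` (all `O(1)`-terms cancel; documented, not instantiated here).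
THREE COLUMNS.  CERTIFIED: identities and a domination criterion for the MODEL's quadratic form (one-surface Newcomb sense).  VALIDATED:
nothing numerical here.  MODELLED: `s–α` model (12.96)–(12.99), `θ₀ = 0`.

## Sources
* J. P. Freidberg, *Ideal MHD*, CUP 2014 [Freidberg2014] §12.6.2 eqs. (12.97)–(12.99); §12.3 (12.38)–(12.40) [corpus: book:freidbergnd-ideal-mhd p0532].
* P. Hartman, *ODE*, SIAM 2002 [Hartman2002] Ch. XI §6 Thm. 6.2 (Picone / Riccati) [corpus: book:hartman2002-ordinary-differential-equations p0337].
-/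

noncomputable section

open Real Set Filter

namespace Literature.MathematicalPhysics.MHD

namespace Ballooning

namespace SAlpha

/-! ## §1 The master phase -/

/-- THE MASTER PHASE `φ(θ) = (Λ(θ)(α cos θ + b) + n(θ))/(1 + Λ(θ)²)`. [cite: Freidberg2014, §12.6.2 eq. (12.97)]
(Riccati phase for its operator; [Hartman2002] Ch. XI §6) -/
def masterPhase (s α b : ℝ) (n : ℝ → ℝ) (θ : ℝ) : ℝ :=
  (shearParam s α θ * (α * Real.cos θ + b) + n θ) / bending s α θ

/-- Its derivative, given `n′`. [cite: Freidberg2014, §12.6.2 eqs. (12.97)–(12.99)] -/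
def masterPhaseDeriv (s α b : ℝ) (n n' : ℝ → ℝ) (θ : ℝ) : ℝ :=
  ((localShear s α θ * (α * Real.cos θ + b) + shearParam s α θ * (α * -Real.sin θ) + n' θ) * bending s α θ
    - (shearParam s α θ * (α * Real.cos θ + b) + n θ) * (2 * shearParam s α θ * localShear s α θ)) / bending s α θ ^ 2

/-- `φ′ = masterPhaseDeriv` wherever `n′` is the derivative of `n`. [cite: Freidberg2014, §12.6.2 eqs. (12.97)–(12.99)] -/
theorem hasDerivAt_masterPhase {s α b : ℝ} {n n' : ℝ → ℝ} {θ : ℝ} (hn : HasDerivAt n (n' θ) θ) :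
    HasDerivAt (masterPhase s α b n) (masterPhaseDeriv s α b n n' θ) θ := by
  have hm : HasDerivAt (fun x => α * Real.cos x + b) (α * -Real.sin θ) θ :=
    ((Real.hasDerivAt_cos θ).const_mul α).add_const b
  have hN : HasDerivAt (fun x => shearParam s α x * (α * Real.cos x + b) + n x)
      (localShear s α θ * (α * Real.cos θ + b) + shearParam s α θ * (α * -Real.sin θ) + n' θ) θ := by
    have h := ((hasDerivAt_shearParam s α θ).mul hm).add hn
    refine (h.congr_of_eventuallyEq (Eventually.of_forall fun x => ?_)).congr_deriv (by ring)
    simp only [Pi.add_apply, Pi.mul_apply]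
  have h := hN.div (hasDerivAt_bending s α θ) (bending_pos s α θ).ne'
  refine (h.congr_of_eventuallyEq (Eventually.of_forall fun x => ?_)).congr_deriv ?_
  · simp only [masterPhase, Pi.div_apply]
  · simp only [masterPhaseDeriv]

/-! ## §2 The identity -/

/-- ★★ THE MASTER IDENTITY: for every `s, α, b`, every `n, n′` and every `θ`,
`ℛ[(Λ(α cos θ + b) + n)/(1 + Λ²)] = α(1 + s + b) cos θ + b(s + b) + n′ + n² − (α cos θ + b − Λn)²/(1 + Λ²)`.
[cite: Freidberg2014, §12.6.2 eqs. (12.97)–(12.99)] with [Hartman2002] Ch. XI §6 Thm. 6.2 -/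
theorem riccatiResidual_masterPhase (s α b : ℝ) (n n' : ℝ → ℝ) (θ : ℝ) :
    riccatiResidual s α (masterPhase s α b n) (masterPhaseDeriv s α b n n') θ
      = α * (1 + s + b) * Real.cos θ + b * (s + b) + n' θ + n θ ^ 2
        - (α * Real.cos θ + b - shearParam s α θ * n θ) ^ 2 / bending s α θ := by
  have hf : bending s α θ ≠ 0 := (bending_pos s α θ).ne'
  have hb : bending s α θ = 1 + shearParam s α θ ^ 2 := rfl
  have hl : localShear s α θ = s - α * Real.cos θ := rfl
  have hd : drive s α θ = α * (shearParam s α θ * Real.sin θ + Real.cos θ) := rfl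
  obtain ⟨L, hL⟩ : ∃ L : ℝ, shearParam s α θ = L := ⟨_, rfl⟩
  obtain ⟨f, hfL⟩ : ∃ f : ℝ, bending s α θ = f := ⟨_, rfl⟩
  rw [hfL] at hf hb
  unfold riccatiResidual masterPhase masterPhaseDeriv
  rw [hl, hd, hfL, hL]
  rw [hL] at hb
  field_simp
  rw [hb]
  ring

/-! ## §3 Domination from one scalar inequality -/

/-- ★★ DOMINATION FROM THE MASTER INEQUALITY: on a set `S`, if `n` has derivative `n′` on `S`, `n′` is continuous on `S`, and
`α(1 + s + b) cos θ + b(s + b) + n′ + n² ≤ (α cos θ + b − Λn)²/(1 + Λ²)` on `S`, then the master phase dominates the `s–α` energy on `S`.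
[cite: Hartman2002, Ch. XI §6 Thm. 6.2] (Picone, via lit-4's `energyDominatesOn_of_riccati`; operator of [Freidberg2014] §12.6.2 (12.97)) -/
theorem energyDominatesOn_masterPhase {s α b : ℝ} {n n' : ℝ → ℝ} {S : Set ℝ}
    (hn : ∀ θ ∈ S, HasDerivAt n (n' θ) θ) (hc : ContinuousOn n' S)
    (hle : ∀ θ ∈ S, α * (1 + s + b) * Real.cos θ + b * (s + b) + n' θ + n θ ^ 2
      ≤ (α * Real.cos θ + b - shearParam s α θ * n θ) ^ 2 / bending s α θ) :
    EnergyDominatesOn s α (masterPhase s α b n) S := by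
  have hnc : ContinuousOn n S := fun θ hθ => (hn θ hθ).continuousAt.continuousWithinAt
  refine energyDominatesOn_of_riccati (fun θ hθ => hasDerivAt_masterPhase (hn θ hθ)) ?_ fun θ hθ => ?_
  · have h1 := continuous_shearParam s α
    have h2 := continuous_localShear s α
    have h3 := continuous_bending s α
    unfold masterPhaseDeriv
    refine ContinuousOn.div ?_ (by fun_prop) fun θ _ => (pow_pos (bending_pos s α θ) 2).ne'
    exact ((((h2.continuousOn.mul (by fun_prop)).add (h1.continuousOn.mul (by fun_prop))).add hc).mul
      h3.continuousOn).sub (((h1.continuousOn.mul (by fun_prop)).add hnc).mul (by fun_prop))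
  · rw [riccatiResidual_masterPhase]
    linarith [hle θ hθ]

/-- ★ … on the whole line: `StableSide s α`. [cite: Hartman2002, Ch. XI §6 Thm. 6.2] with [Freidberg2014] §12.3 (12.38)–(12.40) -/
theorem stableSide_of_masterPhase {s α b : ℝ} {n n' : ℝ → ℝ} (hn : ∀ θ, HasDerivAt n (n' θ) θ) (hc : Continuous n')
    (hle : ∀ θ, α * (1 + s + b) * Real.cos θ + b * (s + b) + n' θ + n θ ^ 2
      ≤ (α * Real.cos θ + b - shearParam s α θ * n θ) ^ 2 / bending s α θ) : StableSide s α :=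
  (energyDominatesOn_masterPhase (S := univ) (fun θ _ => hn θ) hc.continuousOn fun θ _ => hle θ).stableSide

/-- ★ THE CONSTANT CASE `n ≡ 0`: residual `= α(1 + s + b) cos θ + b(s + b) − (α cos θ + b)²/(1 + Λ²)`.
[cite: Freidberg2014, §12.6.2 eqs. (12.97)–(12.99)] with [Hartman2002] Ch. XI §6 Thm. 6.2 -/
theorem riccatiResidual_masterPhase_const (s α b θ : ℝ) :
    riccatiResidual s α (masterPhase s α b fun _ => 0) (masterPhaseDeriv s α b (fun _ => 0) fun _ => 0) θ
      = α * (1 + s + b) * Real.cos θ + b * (s + b) - (α * Real.cos θ + b) ^ 2 / bending s α θ := by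
  rw [riccatiResidual_masterPhase]
  ring

/-- ★ STABLE SIDE FROM ONE CONSTANT: if `|α(1 + s + b)| + b(s + b) ≤ 0` for some real `b`, then `StableSide s α` — solvable in `b` in particular
on `{s ≤ −1}` (`b = −(1 + s)`), on `{α ≥ 0, s ≥ α + 2√α}` (`b = −α − √α`) and on `{0 ≤ α ≤ 1, −1 ≤ s ≤ α − 2√α}` (`b = √α − α`).
[cite: Freidberg2014, §12.6.2 eqs. (12.97)–(12.100)] with [Hartman2002] Ch. XI §6 Thm. 6.2 -/
theorem stableSide_of_const {s α b : ℝ} (h : |α * (1 + s + b)| + b * (s + b) ≤ 0) : StableSide s α := by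
  refine stableSide_of_masterPhase (b := b) (n := fun _ => 0) (n' := fun _ => 0) (fun θ => hasDerivAt_const θ 0)
    continuous_const fun θ => ?_
  have hc1 : α * (1 + s + b) * Real.cos θ ≤ |α * (1 + s + b)| := by
    have := Real.abs_cos_le_one θ
    calc α * (1 + s + b) * Real.cos θ ≤ |α * (1 + s + b) * Real.cos θ| := le_abs_self _
      _ = |α * (1 + s + b)| * |Real.cos θ| := abs_mul _ _
      _ ≤ |α * (1 + s + b)| * 1 := mul_le_mul_of_nonneg_left this (abs_nonneg _)
      _ = |α * (1 + s + b)| := mul_one _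
  have hsq : 0 ≤ (α * Real.cos θ + b) ^ 2 / bending s α θ :=
    div_nonneg (sq_nonneg _) (bending_pos s α θ).le
  simp only [mul_zero, sub_zero, zero_pow two_ne_zero, add_zero]
  linarith

/-- Example: the negative-shear lens `0 ≤ α ≤ 1`, `−1 ≤ s ≤ α − 2√α` from `stableSide_of_const` with `b = √α − α` (the half-plane
`s ≤ −1`, `b = −(1 + s)`, and the first region `s ≥ α + 2√α`, `b = −α − √α`, are `stableSide_of_shear_le_neg_one` /
`stableSide_of_add_two_sqrt_le` of the sibling files — not restated). [cite: Freidberg2014, §12.6.2 eqs. (12.97)–(12.99)] -/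
theorem stableSide_of_const_lens {s α : ℝ} (hα : 0 ≤ α) (hα1 : α ≤ 1) (hs : -1 ≤ s) (h : s ≤ α - 2 * Real.sqrt α) :
    StableSide s α := by
  have ht := Real.sqrt_nonneg α
  have ht1 : Real.sqrt α ≤ 1 := Real.sqrt_le_one.mpr hα1
  have ht2 : Real.sqrt α ^ 2 = α := Real.sq_sqrt hα
  refine stableSide_of_const (b := Real.sqrt α - α) ?_
  have hpos : 0 ≤ α * (1 + s + (Real.sqrt α - α)) := mul_nonneg hα (by nlinarith)
  rw [abs_of_nonneg hpos]
  nlinarith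

/-! ## §4 The Liouville case `b = −s` -/

/-- ★ THE LIOUVILLE CASE `b = −s` (`α cos θ + b = −ŝ`): the phase `(n − Λŝ)/(1 + Λ²)` has residual
`α cos θ + n′ + n² − (ŝ + Λn)²/(1 + Λ²)` — with `n = (1 + Λ²)F′/F` this is `(1 + Λ²)·[F″/F + α cos θ/(1 + Λ²) − ŝ²/(1 + Λ²)²]`, lit-4's
amplitude equation. [cite: Freidberg2014, §12.6.2 eqs. (12.97)–(12.99)] with [Hartman2002] Ch. XI §6 Thm. 6.2 -/
theorem riccatiResidual_masterPhase_liouville (s α : ℝ) (n n' : ℝ → ℝ) (θ : ℝ) :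
    riccatiResidual s α (masterPhase s α (-s) n) (masterPhaseDeriv s α (-s) n n') θ
      = α * Real.cos θ + n' θ + n θ ^ 2 - (localShear s α θ + shearParam s α θ * n θ) ^ 2 / bending s α θ := by
  rw [riccatiResidual_masterPhase]
  have hl : localShear s α θ = s - α * Real.cos θ := rfl
  rw [hl, show α * Real.cos θ + -s - shearParam s α θ * n θ = -(s - α * Real.cos θ + shearParam s α θ * n θ) by ring, neg_sq]
  ring

end SAlpha

end Ballooning

end Literature.MathematicalPhysics.MHD

end
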